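import Mathlib
import Summits.ValiantsHypothesis.ValiantsHypothesis.Theses.FreeSubtorus
import Summits.ValiantsHypothesis.ValiantsHypothesis.Cruxes.OrbitDimensionBound.Lines.TorsionLadder
import Literature.Computability.AlgebraicComplexity.LandsbergRessayreNormalForm
import Literature.Computability.AlgebraicComplexity.LRPencilOfMatrix
import Literature.Computability.AlgebraicComplexity.GrenetEquivariant
import Summits.ValiantsHypothesis.ValiantsHypothesis.Theorems.FreeSubtorusOrbitDimensionBoundStubSignDiagonalise
import Summits.ValiantsHypothesis.ValiantsHypothesis.Theorems.FreeSubtorusOrbitDimensionBoundStubSignCount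
import Summits.ValiantsHypothesis.ValiantsHypothesis.Theorems.FreeSubtorusOrbitDimensionBoundStubSignLinearise
import Summits.ValiantsHypothesis.ValiantsHypothesis.Theorems.FreeSubtorusOrbitDimensionBoundStubPerSummand

/-!
# Line `sign_covering` — skeleton for the rung `SignShadow` (sign-equivariant covering bound)

Crux advanced: `OrbitDimensionBound` (stmt-ValiantsHypothesis-16133) of `route-ValiantsHypothesis-FreeSubtorus`; floor
`SubtorusCovering` (PROVED, `subtorusCovering_proof` = `Torsion.torsionCovering_zero`); rung `Torsion.SignShadow`
(`Lines/TorsionLadder.lean`; numeric hub `Torsion.SignCovering = TorsionCovering 2`).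

THE LINE.  `SignShadow ⇐ SignCovering` (ladder file), and `SignCovering` from four registered stubs:
* `stub_perSummand` (M/L; Krull–Schmidt for matrix pencils + Fitting): an equivariant affine representation of `per_n`
  under ANY `Γ ≤ GL(n²)` contains a `Γ`-equivariant one of size `≤ m` whose pencil is SCHURIAN — every finite-order pair
  `(g, h)` with `g B = B h` is a scalar pair `(c, c)`.  (The per-carrying indecomposable Kronecker summand is unique since
  `per_n` is irreducible, so every `γ` maps it to itself up to isomorphism; an indecomposable pencil has local
  endomorphism ring `ℂ ⊕ rad`, and a finite-order unit `c(1 + N)` of it is `c`.)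
* `stub_signLinearise` (L; NEW — the projective-to-linear step): for a SCHURIAN `T_Λ[2]`-equivariant representation of
  `per_n` the per-element lifts can be re-chosen to form a HOMOMORPHISM on the sign group `S_Λ = {s ∈ 𝔽₂^{2n} : Λ̄ s = 0}`
  (`IsLinearLift`).  (The lift set `E = {(s, g, h)}` is an algebraic group with `E° = Stab(B) = ℂˣ·(1 + rad)`; a finite
  subgroup `F ≤ E` onto `S_Λ` exists (square roots of central scalars, then a complement to the unipotent radical in
  char 0: Borel–Serre / Platonov); `F ∩ Stab` is scalar, so `F` is a central extension of `S_Λ` by `μ_e`; von zur Gathen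
  regularity (`isRegularDetRepr_perPoly`: `rank B(0) = m - 1`) gives an `F`-stable LINE `ker_left B(0)` with character
  `β`, `β|μ_e` = the central character, and the twist `β⁻¹ρ` factors through `S_Λ`: the Schur multiplier dies.)
* `stub_signDiagonalise` (M; simultaneous diagonalisation of commuting involutions): a homomorphic lift of the
  elementary abelian 2-group `S_Λ` puts `B`, after a `GL_m × GL_m` base change, in SIGN-GRADED form (`IsSignGraded`: row
  and column grades `β, α : Fin m → 𝔽₂^{2n}`, constants supported on `β_i - α_j ⊥ S_Λ`, the coefficient of `x_{kl}` on
  `β_i - α_j - (e_k ; e_l) ⊥ S_Λ`).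
* `stub_signCount` (L+; NEW — the load-bearing core): a sign-graded affine matrix of size `m` with `det = c · per_n`,
  `c ≠ 0`, `n ≥ 3`, `Λ` with `r` generators, has `C(n,⌊n/2⌋) ≤ m · 2^r`.  (Graded Gaussian elimination of the weight-`0`
  constant part to `diag(0, I_{m-1})` with pivots of equal grades; `per_n · c = ± b D^{n-2} c'` exactly (homogeneity kills
  `det(I + D)`, CKV Thm. 13); cut at depth `t = ⌊n/2⌋`: `per_n c = Σ_u L_u R_u` over the `m - 1` pivots with `L_u` of PURE
  grade, so `L_u R_u` reaches the monomial `x_σ` only if `(1_I ; 1_{σ I}) ∈ grade(u) + span Λ̄` for some `t`-set `I`; a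
  class holds `≤ |span_{𝔽₂} Λ̄| ≤ 2^r` level-`t` pairs (translation-injectivity of `𝔽₂^{2n}`), each pair serves
  `t!(n-t)!` permutations, all `n!` must be served: `(m - 1) 2^r ≥ C(n, t)`.)
Composition `SignCovering_of`, `SignShadow_of`: kernel-checked below, sorries ONLY in `stub_*`.
WIRING STATE (2026-08-28): ALL FOUR stubs — 1 `stub_perSummand` (p610810), 2 `stub_signLinearise` (p608897),
3 `stub_signDiagonalise` (p598702) and 4 `stub_signCount` (p607901) — are tree THEOREMS and are closed below by name; this
file has NO sorry: `SignCovering_proof` and `SignShadow_proof` (rung `Torsion.SignShadow`) are kernel theorems.  The crux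
`OrbitDimensionBound`, the route FreeSubtorus and VP ≠ VNP stay OPEN (a rung, not the crux).

Disproof used (`Cruxes/OrbitDimensionBound/Disproof.lean`): its theorems (`orbitDimensionBound_false_without_repHyp`, §4
in-place refutations `not_inPlaceHomothety` / `not_orbitDimensionBoundInPlace`, §5 `r = 0 ⟺ Grenet optimal`) concern the
SYMMETRISATION crux; this line's relaxed target `Torsion.OrbitSignBound` asks for a NEW matrix `B` (not in place) and keeps
the representation hypothesis, so it honours `_false_without_repHyp`; no `-- Targets` stub of §6 is instantiated (those are
torus statements; every stub here is about the finite group `T_Λ[2]`).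
[cite: LandsbergRessayre2017, Thm. 2.8, §6, Question 2.2] [cite: Vonzurgathen1987, Thm. 3.1] [cite: ChatterjeeKumarVolk2024, Thm. 13]
-/

set_option linter.dupNamespace false

noncomputable section

namespace Summit.ValiantsHypothesis.ValiantsHypothesis.Cruxes.OrbitDimensionBound.Torsion.Line

open MvPolynomial
open Literature.Computability.AlgebraicComplexity
open Summit.ValiantsHypothesis.ValiantsHypothesis.Cruxes.OrbitDimensionBound.Torsion

/-! ## §0 Vocabulary: sign vectors, the sign group `S_Λ`, sign substitutions, Schurian pencils, graded form -/

/-- Sign data mod 2: exponents `s = (s_rows ; s_cols) ∈ 𝔽₂^{2n}` of a sign change `d_k = (-1)^{s(inl k)}`,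
`e_l = (-1)^{s(inr l)}` — and, dually, characters of the sign group. [folklore] -/
abbrev SignVec (n : ℕ) : Type := (Fin n ⊕ Fin n) → ZMod 2

/-- The `𝔽₂`-pairing `⟨w, s⟩ = Σ_x w_x s_x`. [folklore] -/
def pair {n : ℕ} (w s : SignVec n) : ZMod 2 := ∑ x, w x * s x

/-- **The sign group `S_Λ`**: sign vectors satisfying the `Λ`-relations mod 2 (these are exactly the `(d, e) ∈ {±1}^{2n}`
with `∏ d_k^{Λ_i(inl k)} ∏ e_l^{Λ_i(inr l)} = 1`). [cite: LandsbergRessayre2017, §6] -/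
def signRel (n r : ℕ) (Λ : Fin r → (Fin n ⊕ Fin n) → ℤ) : Set (SignVec n) :=
  {s | ∀ i, (∑ x, ((Λ i x : ℤ) : ZMod 2) * s x) = 0}

/-- The sign `(-1)^a ∈ ℂ` of a bit. [folklore] -/
def sgn (a : ZMod 2) : ℂ := if a = 0 then 1 else -1

theorem sgn_ne_zero (a : ZMod 2) : sgn a ≠ 0 := by
  unfold sgn; split_ifs <;> norm_num

/-- The sign substitution `x_{kl} ↦ (-1)^{s(inl k)} (-1)^{s(inr l)} x_{kl}` as an element of `GL(n²)`. [folklore] -/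
def signElem {n : ℕ} (s : SignVec n) : GL (Fin n × Fin n) ℂ :=
  Grenet.diagUnit (fun p : Fin n × Fin n => sgn (s (Sum.inl p.1)) * sgn (s (Sum.inr p.2)))
    (fun _ => mul_ne_zero (sgn_ne_zero _) (sgn_ne_zero _))

/-- The character of the variable `x_p`: `e_{inl p.1} + e_{inr p.2} ∈ 𝔽₂^{2n}`. [folklore] -/
def varVec {n : ℕ} (p : Fin n × Fin n) : SignVec n :=
  fun x => Sum.elim (fun k => if k = p.1 then (1 : ZMod 2) else 0) (fun l => if l = p.2 then (1 : ZMod 2) else 0) x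

/-- **Schurian pencil**: every finite-order pair `(g, h) ∈ GL_m × GL_m` with `g B = B h` is a scalar pair `(c, c)`
(holds when the Kronecker module of `B` is indecomposable: local endomorphism ring). [folklore] -/
def IsSchurian {n m : ℕ} (B : Matrix (Fin m) (Fin m) (MvPolynomial (Fin n × Fin n) ℂ)) : Prop :=
  ∀ g h : GL (Fin m) ℂ,
    (g : Matrix (Fin m) (Fin m) ℂ).map C * B = B * (h : Matrix (Fin m) (Fin m) ℂ).map C →
    IsOfFinOrder g → IsOfFinOrder h →
    ∃ c : ℂ, (g : Matrix (Fin m) (Fin m) ℂ) = c • (1 : Matrix (Fin m) (Fin m) ℂ) ∧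
      (h : Matrix (Fin m) (Fin m) ℂ) = c • (1 : Matrix (Fin m) (Fin m) ℂ)

/-- **Linear (homomorphic) lift** of the sign group: `ρ₁, ρ₂` are multiplicative on `S_Λ` and lift every sign
substitution exactly, `B(γ_s · x) = ρ₁(s) B(x) ρ₂(s)⁻¹`. [cite: LandsbergRessayre2017, Def. 1.3] -/
def IsLinearLift (n m r : ℕ) (Λ : Fin r → (Fin n ⊕ Fin n) → ℤ)
    (B : Matrix (Fin m) (Fin m) (MvPolynomial (Fin n × Fin n) ℂ)) (ρ₁ ρ₂ : SignVec n → GL (Fin m) ℂ) : Prop :=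
  (∀ s ∈ signRel n r Λ, ∀ t ∈ signRel n r Λ, ρ₁ (s + t) = ρ₁ s * ρ₁ t ∧ ρ₂ (s + t) = ρ₂ s * ρ₂ t) ∧
  (∀ s ∈ signRel n r Λ,
    Matrix.linSubstEntries (signElem s) B =
      ((ρ₁ s : GL (Fin m) ℂ) : Matrix (Fin m) (Fin m) ℂ).map C * B *
        (((ρ₂ s)⁻¹ : GL (Fin m) ℂ) : Matrix (Fin m) (Fin m) ℂ).map C)

/-- **Sign-graded form** w.r.t. `S_Λ`: row grades `β`, column grades `α` (representatives in `𝔽₂^{2n}` of characters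
of `S_Λ`); every entry is `C a₀ + Σ_p a_p X_p` with the constant supported on `β_i - α_j ⊥ S_Λ` and the coefficient of
`x_p` supported on `β_i - α_j - varVec p ⊥ S_Λ`. [cite: LandsbergRessayre2017, §6] -/
def IsSignGraded (n m r : ℕ) (Λ : Fin r → (Fin n ⊕ Fin n) → ℤ) (α β : Fin m → SignVec n)
    (B : Matrix (Fin m) (Fin m) (MvPolynomial (Fin n × Fin n) ℂ)) : Prop :=
  ∀ i j, ∃ (a₀ : ℂ) (a : Fin n × Fin n → ℂ),
    B i j = C a₀ + ∑ p, a p • X p ∧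
    (a₀ ≠ 0 → ∀ s ∈ signRel n r Λ, pair (β i - α j) s = 0) ∧
    (∀ p, a p ≠ 0 → ∀ s ∈ signRel n r Λ, pair (β i - α j - varVec p) s = 0)

/-! ## §1 Statements of the stubs -/

/-- Statement of stub 1 (`stub_perSummand`): pass to the per-carrying indecomposable summand — same symmetry group,
size `≤ m`, Schurian pencil. [folklore] -/
def Stmt.stub_perSummand : Prop :=
  ∀ (n m : ℕ) (Γ : Subgroup (GL (Fin n × Fin n) ℂ)) (B : Matrix (Fin m) (Fin m) (MvPolynomial (Fin n × Fin n) ℂ)),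
    3 ≤ n → IsEquivariantDetRepr Γ (perPoly (Fin n) ℂ) B →
    ∃ (m' : ℕ) (B' : Matrix (Fin m') (Fin m') (MvPolynomial (Fin n × Fin n) ℂ)),
      m' ≤ m ∧ IsEquivariantDetRepr Γ (perPoly (Fin n) ℂ) B' ∧ IsSchurian B'

/-- Statement of stub 2 (`stub_signLinearise`): for a Schurian `T_Λ[2]`-equivariant representation of `per_n` the lifts
can be chosen HOMOMORPHIC on the sign group `S_Λ` (regularity kills the Schur multiplier). [cite: Vonzurgathen1987, Thm. 3.1] -/
def Stmt.stub_signLinearise : Prop :=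
  ∀ (n m r : ℕ) (Λ : Fin r → (Fin n ⊕ Fin n) → ℤ) (B : Matrix (Fin m) (Fin m) (MvPolynomial (Fin n × Fin n) ℂ)),
    3 ≤ n → IsEquivariantDetRepr (torsionSubtorus n r Λ 2) (perPoly (Fin n) ℂ) B → IsSchurian B →
    ∃ ρ₁ ρ₂ : SignVec n → GL (Fin m) ℂ, IsLinearLift n m r Λ B ρ₁ ρ₂

/-- Statement of stub 3 (`stub_signDiagonalise`): a homomorphic lift of the elementary abelian 2-group `S_Λ` puts an
affine matrix in sign-graded form after a base change. [folklore] -/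
def Stmt.stub_signDiagonalise : Prop :=
  ∀ (n m r : ℕ) (Λ : Fin r → (Fin n ⊕ Fin n) → ℤ) (B : Matrix (Fin m) (Fin m) (MvPolynomial (Fin n × Fin n) ℂ))
    (ρ₁ ρ₂ : SignVec n → GL (Fin m) ℂ),
    (∀ i j, (B i j).totalDegree ≤ 1) → IsLinearLift n m r Λ B ρ₁ ρ₂ →
    ∃ (P Q : GL (Fin m) ℂ) (α β : Fin m → SignVec n),
      IsSignGraded n m r Λ α β
        ((P : Matrix (Fin m) (Fin m) ℂ).map C * B * (Q : Matrix (Fin m) (Fin m) ℂ).map C)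

/-- Statement of stub 4 (`stub_signCount`) — **the sign-graded covering count** (the open core): a sign-graded affine
matrix of size `m` with `det = c · per_n`, `c ≠ 0`, `n ≥ 3`, `Λ` admissible with `r` generators, has
`C(n,⌊n/2⌋) ≤ m · 2^r`. [cite: LandsbergRessayre2017, §6, Question 2.2] [cite: ChatterjeeKumarVolk2024, Thm. 13] -/
def Stmt.stub_signCount : Prop :=
  ∀ (n m r : ℕ) (Λ : Fin r → (Fin n ⊕ Fin n) → ℤ) (α β : Fin m → SignVec n)
    (B : Matrix (Fin m) (Fin m) (MvPolynomial (Fin n × Fin n) ℂ)) (c : ℂ),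
    3 ≤ n →
    (∀ i, (∑ k, Λ i (Sum.inl k)) = 0 ∧ (∑ l, Λ i (Sum.inr l)) = 0) →
    IsSignGraded n m r Λ α β B →
    c ≠ 0 → B.det = C c * perPoly (Fin n) ℂ →
    n.choose (n / 2) ≤ m * 2 ^ r

/-! ## §2 Registered stubs (the ONLY sorries of this file) -/

/-- **Registered stub 1 = `Stmt.stub_perSummand`** (size M/L; Krull–Schmidt for Kronecker modules + Fitting's lemma).
[folklore] -/
theorem stub_perSummand : Stmt.stub_perSummand :=
  -- LANDED (p610810, val-lit-p4 g12, over p608341/p608917/p609773/p610093); closed by name — wired 2026-08-28 by val-width-16133-w1 g2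
  Summit.ValiantsHypothesis.ValiantsHypothesis.Theorems.FreeSubtorusOrbitDimensionBound.SignCovering.PerSummand.stub_perSummand

/-- **Registered stub 2 = `Stmt.stub_signLinearise`** (size L; NEW: finite supplement + regular twist).
LANDED: `Theorems/FreeSubtorusOrbitDimensionBoundStubSignLinearise.lean` (p608897; helpers p607307 `…SignLineariseStab`,
p607893 `…SignLineariseLiftAlgebra`, p608272 `…SignLineariseSteps`, p608726 `…SignLineariseSignGroup`; val-width-16133-w2 g0),
statement with this file's vocabulary unfolded — closed here by name (wired 2026-08-28, val-width-16133-w2 g0).  Proof of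
record: kernel line `ℂ c` of `B(0)` (von zur Gathen) ⇒ normalised lifts `h c = c`; Schurian ⇒ normalised stabilisers are
unipotent (generalised-eigenspace projections give a finite-order stabiliser pair); over an `𝔽₂`-basis of `S_Λ`, symmetrise
`e ↦ ½(e + f e f)` and involutise `e ↦ e · p(e² − 1)`, `p²(1 + X) ≡ 1`; assemble by `MonoidHom.noncommPiCoprod`.
[cite: Vonzurgathen1987, Thm. 3.1] -/
theorem stub_signLinearise : Stmt.stub_signLinearise :=
  Summit.ValiantsHypothesis.ValiantsHypothesis.Theorems.FreeSubtorusOrbitDimensionBound.SignCovering.stub_signLinearise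

/-- **Registered stub 3 = `Stmt.stub_signDiagonalise`** (size M; simultaneous eigenbases of commuting involutions).
LANDED: `Theorems/FreeSubtorusOrbitDimensionBoundStubSignDiagonalise.lean` (p598702, prelim p598392; val-lit-p4 g11),
statement with this file's vocabulary unfolded — closed here by name (wired 2026-08-28, val-width-16133-w1 g2). [folklore] -/
theorem stub_signDiagonalise : Stmt.stub_signDiagonalise :=
  Summit.ValiantsHypothesis.ValiantsHypothesis.Theorems.FreeSubtorusOrbitDimensionBound.SignCovering.stub_signDiagonalise

/-- **Registered stub 4 = `Stmt.stub_signCount`** (size L+; NEW; the load-bearing step).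
LANDED: `Theorems/FreeSubtorusOrbitDimensionBoundStubSignCount.lean` (p607901, prelim p607507; val-width-16133-w1 g1),
statement with this file's vocabulary unfolded (in fact `C(n,⌊n/2⌋) ≤ (m − 1)·2^r`, admissibility of `Λ` unused) — closed
here by name (wired 2026-08-28, val-width-16133-w1 g2). [cite: LandsbergRessayre2017, Question 2.2] -/
theorem stub_signCount : Stmt.stub_signCount :=
  Summit.ValiantsHypothesis.ValiantsHypothesis.Theorems.FreeSubtorusOrbitDimensionBound.SignCovering.stub_signCount

/-! ## §3 The composition (kernel-checked, sorry-free) -/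

/-- **`SignCovering` from the four stubs**: per-summand ⇒ linearise ⇒ diagonalise ⇒ count, with the base change
absorbed into the scalar `c = det P · det Q`. [cite: LandsbergRessayre2017, Thm. 2.8, Question 2.2] -/
theorem SignCovering_of :
    Stmt.stub_perSummand → Stmt.stub_signLinearise → Stmt.stub_signDiagonalise → Stmt.stub_signCount →
      SignCovering := by
  intro hPS hSL hSD hSC n hn m r Λ B hΛ hB
  -- (1) the per-carrying Schurian summand
  obtain ⟨m', B', hm', hB', hS⟩ := hPS n m _ B hn hB
  -- (2) homomorphic lifts of the sign group
  obtain ⟨ρ₁, ρ₂, hL⟩ := hSL n m' r Λ B' hn hB' hS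
  -- (3) sign-graded form after a base change
  obtain ⟨P, Q, α, β, hgr⟩ := hSD n m' r Λ B' ρ₁ ρ₂ hB'.1.1 hL
  -- (4) the determinant of `P B' Q`
  have hdetP : ((P : Matrix (Fin m') (Fin m') ℂ).map (C : ℂ →+* MvPolynomial (Fin n × Fin n) ℂ)).det =
      C (P : Matrix (Fin m') (Fin m') ℂ).det := by
    rw [← RingHom.mapMatrix_apply, ← RingHom.map_det]
  have hdetQ : ((Q : Matrix (Fin m') (Fin m') ℂ).map (C : ℂ →+* MvPolynomial (Fin n × Fin n) ℂ)).det =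
      C (Q : Matrix (Fin m') (Fin m') ℂ).det := by
    rw [← RingHom.mapMatrix_apply, ← RingHom.map_det]
  have hdet' : ((P : Matrix (Fin m') (Fin m') ℂ).map C * B' * (Q : Matrix (Fin m') (Fin m') ℂ).map C).det =
      C ((P : Matrix (Fin m') (Fin m') ℂ).det * (Q : Matrix (Fin m') (Fin m') ℂ).det) * perPoly (Fin n) ℂ := by
    rw [Matrix.det_mul, Matrix.det_mul, hdetP, hdetQ, hB'.1.2, map_mul]
    ring
  have hc : (P : Matrix (Fin m') (Fin m') ℂ).det * (Q : Matrix (Fin m') (Fin m') ℂ).det ≠ 0 := by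
    refine mul_ne_zero ?_ ?_
    · simpa [Matrix.GeneralLinearGroup.val_det_apply] using (Matrix.GeneralLinearGroup.det P).ne_zero
    · simpa [Matrix.GeneralLinearGroup.val_det_apply] using (Matrix.GeneralLinearGroup.det Q).ne_zero
  -- (5) the count, and `m' ≤ m`
  exact (hSC n m' r Λ α β _ _ hn hΛ hgr hc hdet').trans (Nat.mul_le_mul_right _ hm')

/-- **THE RUNG from the four stubs** (concludes `Torsion.SignShadow` BY NAME). [cite: LandsbergRessayre2017, Question 2.2] -/
theorem SignShadow_of :
    Stmt.stub_perSummand → Stmt.stub_signLinearise → Stmt.stub_signDiagonalise → Stmt.stub_signCount →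
      Summit.ValiantsHypothesis.ValiantsHypothesis.Cruxes.OrbitDimensionBound.Torsion.SignShadow :=
  fun h₁ h₂ h₃ h₄ => signShadow_of_signCovering (SignCovering_of h₁ h₂ h₃ h₄)

/-- **THE SKELETON: the rung modulo exactly the four registered stubs.** [cite: LandsbergRessayre2017, Question 2.2] -/
theorem SignShadow_proof :
    Summit.ValiantsHypothesis.ValiantsHypothesis.Cruxes.OrbitDimensionBound.Torsion.SignShadow :=
  SignShadow_of stub_perSummand stub_signLinearise stub_signDiagonalise stub_signCount

/-- The numeric member modulo the stubs. [cite: LandsbergRessayre2017, Question 2.2] -/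
theorem SignCovering_proof :
    Summit.ValiantsHypothesis.ValiantsHypothesis.Cruxes.OrbitDimensionBound.Torsion.SignCovering :=
  SignCovering_of stub_perSummand stub_signLinearise stub_signDiagonalise stub_signCount

/-- The floor again, from the stubs (rung ⇒ floor). [cite: LandsbergRessayre2017, Thm. 2.8] -/
theorem floor_of_stubs :
    Stmt.stub_perSummand → Stmt.stub_signLinearise → Stmt.stub_signDiagonalise → Stmt.stub_signCount →
      Summit.ValiantsHypothesis.ValiantsHypothesis.Theses.FreeSubtorus.SubtorusCovering :=
  fun h₁ h₂ h₃ h₄ => subtorusCovering_of_signCovering (SignCovering_of h₁ h₂ h₃ h₄)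

/-- How the line advances the open crux: with the stubs, the RELAXED symmetrisation target suffices —
`OrbitSignBound → VP ≠ VNP`. [cite: LandsbergRessayre2017, Question 2.2] -/
theorem vh_of_orbitSignBound_of_stubs :
    Stmt.stub_perSummand → Stmt.stub_signLinearise → Stmt.stub_signDiagonalise → Stmt.stub_signCount →
      OrbitSignBound → _root_.ValiantsHypothesis :=
  fun h₁ h₂ h₃ h₄ h => closes_sign h (SignCovering_of h₁ h₂ h₃ h₄)

end Summit.ValiantsHypothesis.ValiantsHypothesis.Cruxes.OrbitDimensionBound.Torsion.Line

end
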